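import Mathlib
import Literature.Computability.AlgebraicComplexity.OrbitClosure
import Literature.Computability.AlgebraicComplexity.BorderApolarityMembership
import Literature.Computability.AlgebraicComplexity.PaddedPermanentPartials
import Summits.ValiantsHypothesis.ValiantsHypothesis.Theorems.BorderApolarityFixedWitnessObstructionQPUnpad

/-!
# Border apolarity, crux `ToricWitnessObstructionQP` — stub `stub_lieStabilizer_padded`
# (S3, the Lie stabiliser of the padded permanent, from S2)

Route `ValiantsHypothesis/BorderApolarity`, crux item `stmt-ValiantsHypothesis-14753`,
line `Sketch`, stub `stub_lieStabilizer_padded`.  For `3 ≤ n ≤ m` let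
`pp = paddedPerPoly ℂ n m = ℓ ^ p · P` with `ℓ = X (0,0)`, `p = m - n` and `P` the permanent of the
block variables `(i, j)`, `m - n ≤ i, j` (renamed from `perPoly (BlockIdx n m) ℂ` along the block
embedding `ι`).  If the infinitesimal substitution `E_N = ∑_{a,b} N_{ba} X_b ∂_a` rescales `pp`,
then every column of `N` at a variable of `pp` (block variable or `ℓ`) is a multiple of the
coordinate vector, and the diagonal of `N` on the block is exchange-additive.  The statement for
`per_n` itself (stub S2, `stub_lieStabilizer_per`) is taken as a hypothesis.

Proof.  (0) S2 is transported from `Fin n` to the block index type `B = BlockIdx n m` along a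
bijection `B ≃ Fin n` (`rename_prodMap_perPoly`; `perPoly_lieStab_transport`), and with `c = 0`
it yields the linear independence of the partials `∂_a per_B` (`perPoly_partials_indep`).
(A) For a variable `z` off the block and `≠ ℓ`, applying `∂_z` to the relation kills the
right-hand side and the second-order terms (`pp` is `z`-free), leaving `∑_a N_{za} ∂_a pp = 0`.
(B) The substitution `φ : ℓ ↦ 1`, block variables to themselves, other variables `↦ 0` maps
`pp ↦ per_B`, `∂_{ι a} pp ↦ ∂_a per_B`, `∂_ℓ pp ↦ p · per_B`; applied to the relation (and to
(A)) it produces identities in `ℂ[B × B]` whose summands are homogeneous of degrees `n - 1`, `n`,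
`n + 1` (tree file `Literature/.../PaddedPermanentPartials.lean`: `paddedPerPoly_lieRel_subst_pos`,
`paddedPerPoly_lieRel_row`); separating degrees gives `∑_a N_{ℓ,ιa} ∂_a per_B = 0` (so
`N_{ℓ,ιa} = 0`), `(∑_b N_{ιb,ℓ} X_b) · p · per_B = 0` (so `N_{ιb,ℓ} = 0`, `p ≥ 1`), and
`∑ N_{ιb,ιa} X_b ∂_a per_B = (c - p N_{ℓℓ}) · per_B`, which is S2 on the block.  For `p = 0` the
block is everything and only the last identity remains (`paddedPerPoly_lieRel_subst_zero`).
-/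

open MvPolynomial
open scoped BigOperators Matrix
open Literature.Computability.AlgebraicComplexity

-- the mandated summit-side namespace repeats a component by design (single-problem summit)
set_option linter.dupNamespace false

namespace Summit.ValiantsHypothesis.ValiantsHypothesis.Theorems.BorderApolarityToricWitnessObstructionQP

open Summit.ValiantsHypothesis.ValiantsHypothesis.Theorems.BorderApolarityFixedWitnessObstructionQP
  (rename_prodMap_perPoly)

/-! ## S2 on an arbitrary index type of cardinality `n` -/

/-- **Transport of S2.** The Lie-stabiliser statement for `perPoly (Fin n) ℂ` implies the same
statement for `perPoly B ℂ` for every index type `B ≃ Fin n`: rename along `Prod.map e e`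
(`rename_prodMap_perPoly`, `pderiv_rename`) and reindex the sums. [folklore] -/
theorem perPoly_lieStab_transport {B : Type*} [Fintype B] [DecidableEq B] {n : ℕ} (e : B ≃ Fin n)
    (hPer : ∀ (M : Matrix (Fin n × Fin n) (Fin n × Fin n) ℂ) (c : ℂ),
      ∑ a, ∑ b, M b a • (X b * pderiv a (perPoly (Fin n) ℂ)) = c • perPoly (Fin n) ℂ →
      (∀ a b : Fin n × Fin n, b ≠ a → M b a = 0) ∧
      (∀ i j k l : Fin n, M (i, j) (i, j) + M (k, l) (k, l) = M (i, l) (i, l) + M (k, j) (k, j)))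
    (M : Matrix (B × B) (B × B) ℂ) (c : ℂ)
    (hM : ∑ a, ∑ b, M b a • (X b * pderiv a (perPoly B ℂ)) = c • perPoly B ℂ) :
    (∀ a b : B × B, b ≠ a → M b a = 0) ∧
      (∀ i j k l : B, M (i, j) (i, j) + M (k, l) (k, l) = M (i, l) (i, l) + M (k, j) (k, j)) := by
  have hinj : Function.Injective (Prod.map e e) := e.injective.prodMap e.injective
  have h := congr_arg (rename (Prod.map e e)) hM
  simp only [map_sum, map_smul, map_mul, rename_X, ← pderiv_rename hinj,
    rename_prodMap_perPoly] at h
  have h' : ∑ a, ∑ b, M ((e.prodCongr e).symm b) ((e.prodCongr e).symm a) •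
      (X b * pderiv a (perPoly (Fin n) ℂ)) = c • perPoly (Fin n) ℂ := by
    rw [← h]
    symm
    refine Fintype.sum_equiv (e.prodCongr e) _ _ fun a => ?_
    refine Fintype.sum_equiv (e.prodCongr e) _ _ fun b => ?_
    obtain ⟨a1, a2⟩ := a
    obtain ⟨b1, b2⟩ := b
    simp
  obtain ⟨h1, h2⟩ := hPer _ c h'
  refine ⟨fun a b hab => ?_, fun i j k l => ?_⟩
  · have := h1 (e.prodCongr e a) (e.prodCongr e b) fun h => hab ((e.prodCongr e).injective h)
    obtain ⟨a1, a2⟩ := a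
    obtain ⟨b1, b2⟩ := b
    simpa using this
  · have := h2 (e i) (e j) (e k) (e l)
    simpa using this

/-- **Linear independence of the partials of the permanent, from S2.** If S2 (off-diagonal part)
holds for `perPoly B ℂ` and `3 ≤ |B|`, then `∑_a r_a ∂_a per_B = 0` forces `r = 0`: multiply by
a variable `X_{b₀}`, `b₀ ≠ a`, and read S2 with `c = 0`. [folklore] -/
theorem perPoly_partials_indep {B : Type*} [Fintype B] [DecidableEq B] (h3 : 3 ≤ Fintype.card B)
    (hoff : ∀ (M : Matrix (B × B) (B × B) ℂ) (c : ℂ),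
      ∑ a, ∑ b, M b a • (X b * pderiv a (perPoly B ℂ)) = c • perPoly B ℂ →
      ∀ a b : B × B, b ≠ a → M b a = 0)
    (r : B × B → ℂ) (hr : ∑ a, r a • pderiv a (perPoly B ℂ) = 0) (a : B × B) : r a = 0 := by
  haveI : Nontrivial B := Fintype.one_lt_card_iff_nontrivial.1 (by omega)
  obtain ⟨j, hj⟩ := exists_ne a.2
  have hb : (a.1, j) ≠ a := fun h => hj (congr_arg Prod.snd h)
  have key : ∑ a', ∑ b, (fun b a' => if b = (a.1, j) then r a' else 0) b a' •
      (X b * pderiv a' (perPoly B ℂ)) = (0 : ℂ) • perPoly B ℂ := by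
    simp only [ite_smul, zero_smul, Finset.sum_ite_eq', Finset.mem_univ, if_true]
    calc ∑ a', r a' • (X (a.1, j) * pderiv a' (perPoly B ℂ))
        = X (a.1, j) * ∑ a', r a' • pderiv a' (perPoly B ℂ) := by
          rw [Finset.mul_sum]
          exact Finset.sum_congr rfl fun a' _ => (mul_smul_comm _ _ _).symm
      _ = 0 := by rw [hr, mul_zero]
  have := hoff _ 0 key a (a.1, j) hb
  simpa using this

/-! ## S3: the Lie stabiliser of the padded permanent -/

/-- **S3 (Lie stabiliser of the padded permanent, from S2).** For `3 ≤ n ≤ m` and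
`pp = X₀₀^{m-n} per_n` (per-block = indices `≥ m - n`): if `Σ_{a,b} N_{ba} X_b ∂_a pp = c · pp`
then every column of `N` at a variable of `pp` (block variable or `X₀₀`) is a multiple of the
coordinate vector, and the diagonal of `N` on the block is exchange-additive.  The first hypothesis
is S2 (the Lie stabiliser of `per_n`; Marcus–May 1962, Botta 1967; Landsberg 2017, §6.6), which is
transported to the block and also supplies the linear independence of the partials of the
permanent; the rest is degree bookkeeping in `ℓ` and in the variables off the block. [folklore] -/
theorem stub_lieStabilizer_padded :
    (∀ (n : ℕ), 3 ≤ n → ∀ (M : Matrix (Fin n × Fin n) (Fin n × Fin n) ℂ) (c : ℂ),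
      ∑ a, ∑ b, M b a • (X b * pderiv a (perPoly (Fin n) ℂ)) = c • perPoly (Fin n) ℂ →
      (∀ a b : Fin n × Fin n, b ≠ a → M b a = 0) ∧
      (∀ i j k l : Fin n, M (i, j) (i, j) + M (k, l) (k, l) = M (i, l) (i, l) + M (k, j) (k, j))) →
    ∀ (n m : ℕ) [NeZero m], 3 ≤ n → n ≤ m →
    ∀ (N : Matrix (Fin m × Fin m) (Fin m × Fin m) ℂ) (c : ℂ),
    ∑ a, ∑ b, N b a • (X b * pderiv a (paddedPerPoly ℂ n m)) = c • paddedPerPoly ℂ n m →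
    (∀ a : Fin m × Fin m, ((m - n ≤ (a.1 : ℕ) ∧ m - n ≤ (a.2 : ℕ)) ∨ a = (0, 0)) →
      ∀ b : Fin m × Fin m, b ≠ a → N b a = 0) ∧
    (∀ i j k l : Fin m, m - n ≤ (i : ℕ) → m - n ≤ (k : ℕ) → m - n ≤ (j : ℕ) → m - n ≤ (l : ℕ) →
      N (i, j) (i, j) + N (k, l) (k, l) = N (i, l) (i, l) + N (k, j) (k, j)) := by
  intro hPer n m _ hn hnm N c hN
  -- (0) S2 on the block index type `B`, and the linear independence of the partials of `per_B`
  have hPerB :=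
    perPoly_lieStab_transport (Fintype.equivFinOfCardEq (card_blockIdx hnm)) (hPer n hn)
  have h3 : 3 ≤ Fintype.card (BlockIdx n m) := by rw [card_blockIdx hnm]; exact hn
  have hd : 0 < Fintype.card (BlockIdx n m) := by omega
  have hindep := perPoly_partials_indep h3 fun M c' h => (hPerB M c' h).1
  -- the substitution `φ`
  obtain ⟨g, hgb, hg0, hgz⟩ := paddedPerPoly_exists_subst n m
  -- block variables are in the range of the block embedding
  have hrange : ∀ a : Fin m × Fin m, m - n ≤ (a.1 : ℕ) ∧ m - n ≤ (a.2 : ℕ) →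
      ∃ a' : BlockIdx n m × BlockIdx n m, ((a'.1 : Fin m), (a'.2 : Fin m)) = a :=
    fun a ha => ⟨(⟨a.1, ha.1⟩, ⟨a.2, ha.2⟩), rfl⟩
  rcases Nat.eq_zero_or_pos (m - n) with hp | hp
  · -- `p = 0`: the block is everything, the relation after `φ` is S2 on the block
    have hall : ∀ z : Fin m × Fin m, m - n ≤ (z.1 : ℕ) ∧ m - n ≤ (z.2 : ℕ) := fun z => by
      rw [hp]; exact ⟨Nat.zero_le _, Nat.zero_le _⟩
    obtain ⟨hoff, hadd⟩ := hPerB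
      (fun b a => N ((b.1 : Fin m), (b.2 : Fin m)) ((a.1 : Fin m), (a.2 : Fin m))) c
      (paddedPerPoly_lieRel_subst_zero hgb hg0 hp N c hN)
    refine ⟨fun a _ b hab => ?_,
      fun i j k l hi hk hj hl => hadd ⟨i, hi⟩ ⟨j, hj⟩ ⟨k, hk⟩ ⟨l, hl⟩⟩
    obtain ⟨a', rfl⟩ := hrange a (hall a)
    obtain ⟨b', rfl⟩ := hrange b (hall b)
    exact hoff a' b' fun h => hab (by rw [h])
  · -- `p ≥ 1`
    have hhom : (perPoly (BlockIdx n m) ℂ).IsHomogeneous (Fintype.card (BlockIdx n m)) :=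
      perPoly_isHomogeneous
    have hne : perPoly (BlockIdx n m) ℂ ≠ 0 := perPoly_ne_zero _ _
    have hpper : ((m - n : ℕ) : ℂ) • perPoly (BlockIdx n m) ℂ ≠ 0 :=
      smul_ne_zero (Nat.cast_ne_zero.2 hp.ne') hne
    -- homogeneity bookkeeping: degrees `n`, `n - 1`, `n + 1`
    have hdeg : 1 + (Fintype.card (BlockIdx n m) - 1) = Fintype.card (BlockIdx n m) := by omega
    have hXD : ∀ (a b : BlockIdx n m × BlockIdx n m) (r : ℂ),
        (r • (X b * pderiv a (perPoly (BlockIdx n m) ℂ))).IsHomogeneous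
          (Fintype.card (BlockIdx n m)) := fun a b r => by
      have h := (isHomogeneous_X ℂ b).mul (hhom.pderiv (i := a))
      rw [hdeg] at h
      exact isHomogeneous_const_smul h r
    have hD : ∀ (a : BlockIdx n m × BlockIdx n m) (r : ℂ),
        (r • pderiv a (perPoly (BlockIdx n m) ℂ)).IsHomogeneous
          (Fintype.card (BlockIdx n m) - 1) := fun a r =>
      isHomogeneous_const_smul hhom.pderiv r
    have hXP : ∀ (b : BlockIdx n m × BlockIdx n m) (r s : ℂ),
        (r • (X b * (s • perPoly (BlockIdx n m) ℂ))).IsHomogeneous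
          (Fintype.card (BlockIdx n m) + 1) := fun b r s => by
      have h := (isHomogeneous_X ℂ b).mul (isHomogeneous_const_smul hhom s)
      rw [add_comm] at h
      exact isHomogeneous_const_smul h r
    -- (B) the relation after `φ`, separated by degree
    have hrel := paddedPerPoly_lieRel_subst_pos hgb hg0 hp hgz N c hN
    obtain ⟨hA, hB, hC⟩ := isHomogeneous_separate_three hd
      (by exact (IsHomogeneous.sum _ _ _ fun a _ => IsHomogeneous.sum _ _ _ fun b _ =>
        hXD a b _).add (isHomogeneous_const_smul hhom _))
      (by exact IsHomogeneous.sum _ _ _ fun a _ => hD a _)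
      (by exact IsHomogeneous.sum _ _ _ fun b _ => hXP b _ _)
      (by exact isHomogeneous_const_smul hhom c) hrel
    -- degree `n`: S2 on the block
    have hT1 : ∑ a : BlockIdx n m × BlockIdx n m, ∑ b : BlockIdx n m × BlockIdx n m,
        N ((b.1 : Fin m), (b.2 : Fin m)) ((a.1 : Fin m), (a.2 : Fin m)) •
          (X b * pderiv a (perPoly (BlockIdx n m) ℂ)) =
        (c - N (0, 0) (0, 0) * ((m - n : ℕ) : ℂ)) • perPoly (BlockIdx n m) ℂ := by
      rw [sub_smul, ← hA, add_sub_cancel_right]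
    obtain ⟨hoff, hadd⟩ := hPerB
      (fun b a => N ((b.1 : Fin m), (b.2 : Fin m)) ((a.1 : Fin m), (a.2 : Fin m))) _ hT1
    -- degree `n - 1`: the row of `ℓ` on the block vanishes
    have hR2 : ∀ a : BlockIdx n m × BlockIdx n m,
        N (0, 0) ((a.1 : Fin m), (a.2 : Fin m)) = 0 := hindep _ hB
    -- degree `n + 1`: the column of `ℓ` on the block vanishes
    have hR3 : ∀ b : BlockIdx n m × BlockIdx n m,
        N ((b.1 : Fin m), (b.2 : Fin m)) (0, 0) = 0 := by
      have hsum : (∑ b : BlockIdx n m × BlockIdx n m, N ((b.1 : Fin m), (b.2 : Fin m)) (0, 0) •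
          (X b : MvPolynomial (BlockIdx n m × BlockIdx n m) ℂ)) *
            (((m - n : ℕ) : ℂ) • perPoly (BlockIdx n m) ℂ) = 0 := by
        rw [← hC, Finset.sum_mul]
        exact Finset.sum_congr rfl fun b _ => smul_mul_assoc _ _ _
      exact Fintype.linearIndependent_iff.1 (linearIndependent_X _ ℂ) _
        ((mul_eq_zero.1 hsum).resolve_right hpper)
    -- (A) rows off the block
    have hR1 : ∀ z : Fin m × Fin m, ¬ (m - n ≤ (z.1 : ℕ) ∧ m - n ≤ (z.2 : ℕ)) → z ≠ (0, 0) →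
        N z (0, 0) = 0 ∧
          ∀ a : BlockIdx n m × BlockIdx n m, N z ((a.1 : Fin m), (a.2 : Fin m)) = 0 := by
      intro z hz hz0
      have hrow : N z (0, 0) • (((m - n : ℕ) : ℂ) • perPoly (BlockIdx n m) ℂ) +
          ∑ a : BlockIdx n m × BlockIdx n m,
            N z ((a.1 : Fin m), (a.2 : Fin m)) • pderiv a (perPoly (BlockIdx n m) ℂ) + 0 = 0 := by
        rw [add_zero]
        exact paddedPerPoly_lieRel_row hgb hg0 hp N c hN hz hz0
      obtain ⟨hA', hB', -⟩ := isHomogeneous_separate_three hd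
        (by exact isHomogeneous_const_smul (isHomogeneous_const_smul hhom _) _)
        (by exact IsHomogeneous.sum _ _ _ fun a _ => hD a _)
        (isHomogeneous_zero _ _ _) (isHomogeneous_zero _ _ _) hrow
      exact ⟨(smul_eq_zero.1 hA').resolve_right hpper, hindep _ hB'⟩
    -- assembly
    refine ⟨fun a ha b hab => ?_,
      fun i j k l hi hk hj hl => hadd ⟨i, hi⟩ ⟨j, hj⟩ ⟨k, hk⟩ ⟨l, hl⟩⟩
    rcases ha with ha | rfl
    · obtain ⟨a', rfl⟩ := hrange a ha
      by_cases hb : m - n ≤ (b.1 : ℕ) ∧ m - n ≤ (b.2 : ℕ)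
      · obtain ⟨b', rfl⟩ := hrange b hb
        exact hoff a' b' fun h => hab (by rw [h])
      · by_cases hb0 : b = (0, 0)
        · rw [hb0]
          exact hR2 a'
        · exact (hR1 b hb hb0).2 a'
    · by_cases hb : m - n ≤ (b.1 : ℕ) ∧ m - n ≤ (b.2 : ℕ)
      · obtain ⟨b', rfl⟩ := hrange b hb
        exact hR3 b'
      · exact (hR1 b hb hab).1

end Summit.ValiantsHypothesis.ValiantsHypothesis.Theorems.BorderApolarityToricWitnessObstructionQP
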